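import Summits.HubbardSuperconductivity.HubbardSuperconductivity.Theorems.NodalWardXYDefs

/-!
# `PerturbedXYOrder` (stmt-HubbardSuperconductivity-10739) — line `schwarz-inheritance`, stub `stub_schwarzInheritance`

Schwarz-lemma transfer: stability on a larger radius + real plateau ⇒ plateau at the smaller radius.
-/

noncomputable section

namespace Summit.HubbardSuperconductivity.HubbardSuperconductivity.Theorems.PerturbedXYOrder

open MeasureTheory Literature.Probability.LatticeModels
open Summit.HubbardSuperconductivity.HubbardSuperconductivity.Theses.NodalWardXY


/-- Scaling of admissible kernels: if `K` is admissible at radius `ε` and `‖c‖ * ε ≤ ε'`, then `c • K` is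
admissible at radius `ε'`. (Adapted from the line skeleton's `admissible_smul`.) [folklore] -/
theorem sch_admissible_smul {L : ℕ} [NeZero L] {ε ε' : ℝ} {c : ℂ} (hc : ‖c‖ * ε ≤ ε')
    {K : Bond L → Bond L → ℂ} (hK : Admissible L ε K) : Admissible L ε' (c • K) := by
  intro b b'
  have hd : (0:ℝ) < (1 + ((torusGraph 3 L).dist b.1 b'.1 : ℝ)) ^ 4 := by positivity
  calc ‖(c • K) b b'‖ = ‖c‖ * ‖K b b'‖ := by simp
    _ ≤ ‖c‖ * (ε / (1 + ((torusGraph 3 L).dist b.1 b'.1 : ℝ)) ^ 4) :=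
        mul_le_mul_of_nonneg_left (hK b b') (norm_nonneg _)
    _ = (‖c‖ * ε) / (1 + ((torusGraph 3 L).dist b.1 b'.1 : ℝ)) ^ 4 := by ring
    _ ≤ ε' / (1 + ((torusGraph 3 L).dist b.1 b'.1 : ℝ)) ^ 4 := div_le_div_of_nonneg_right hc hd.le

/-- The zero kernel is admissible at every nonnegative radius. [folklore] -/
theorem sch_admissible_zero {L : ℕ} [NeZero L] {ε : ℝ} (hε : 0 ≤ ε) :
    Admissible L ε (0 : Bond L → Bond L → ℂ) := by
  intro b b'
  simp only [Pi.zero_apply, norm_zero]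
  positivity

/-- **Schwarz inheritance.** Stability on radius `ε₁` (`Z ≠ 0`, `‖cratio‖ ≤ B`) and the real `K = 0` plateau `≥ a₀`
give `Z ≠ 0` and `Re cratio ≥ a₀/2` at radius `ε₁ a₀/(4B)`: `g(z) = cratio(zK)` is holomorphic with `‖g‖ ≤ B` on the ball
`‖z‖ < 4B/a₀` (there `zK` is admissible at radius `ε₁`), so `‖g(1) − g(0)‖ ≤ 2B·a₀/(4B) = a₀/2`
(`Complex.dist_le_div_mul_dist_of_mapsTo_ball`). [folklore] -/
theorem stub_schwarzInheritance :
    ∀ (J : ℝ) (L : ℕ) [NeZero L] (ε₁ B a₀ : ℝ), 0 < ε₁ → 0 < a₀ →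
      (∀ K : Bond L → Bond L → ℂ,
        Differentiable ℂ (fun t : ℂ => Zk J (t • K)) ∧ Differentiable ℂ (fun t : ℂ => num J (t • K))) →
      (∀ K : Bond L → Bond L → ℂ, Admissible L ε₁ K → Zk J K ≠ 0 ∧ ‖cratio L J K‖ ≤ B) →
      a₀ ≤ (cratio L J 0).re →
      ∀ K : Bond L → Bond L → ℂ, Admissible L (ε₁ * a₀ / (4 * B)) K →
        Zk J K ≠ 0 ∧ a₀ / 2 ≤ (cratio L J K).re := by
  intro J L _ ε₁ B a₀ hε₁ ha₀ hdiff hstab hplat K hK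
  -- Step 0: constants.
  have hB0 : ‖cratio L J 0‖ ≤ B := (hstab 0 (sch_admissible_zero hε₁.le)).2
  have ha₀B : a₀ ≤ B := hplat.trans ((Complex.re_le_norm _).trans hB0)
  have hB : 0 < B := ha₀.trans_le ha₀B
  set ε : ℝ := ε₁ * a₀ / (4 * B) with hε_def
  have hε : 0 < ε := by positivity
  set R : ℝ := 4 * B / a₀ with hR_def
  have hR1 : 1 < R := by
    rw [hR_def, lt_div_iff₀ ha₀]
    linarith
  have hRpos : 0 < R := one_pos.trans hR1
  have hRε : R * ε = ε₁ := by
    rw [hR_def, hε_def]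
    field_simp
  -- Step 1: balancedness — on the ball `‖z‖ < R`, `z • K` is admissible at radius `ε₁`.
  have hadm : ∀ z : ℂ, z ∈ Metric.ball (0:ℂ) R → Admissible L ε₁ (z • K) := by
    intro z hz
    rw [Metric.mem_ball, dist_zero_right] at hz
    refine sch_admissible_smul ?_ hK
    calc ‖z‖ * ε ≤ R * ε := mul_le_mul_of_nonneg_right hz.le hε.le
      _ = ε₁ := hRε
  have h1 : (1:ℂ) ∈ Metric.ball (0:ℂ) R := by
    rw [Metric.mem_ball, dist_zero_right, norm_one]
    exact hR1
  have hZK : Zk J K ≠ 0 := by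
    have := (hstab _ (hadm 1 h1)).1
    simpa using this
  refine ⟨hZK, ?_⟩
  -- Step 2: holomorphy of `g z = cratio L J (z • K)` on the ball.
  set g : ℂ → ℂ := fun z => cratio L J (z • K) with hg_def
  have hg_diff : DifferentiableOn ℂ g (Metric.ball (0:ℂ) R) := by
    show DifferentiableOn ℂ (fun z : ℂ => num J (z • K) / Zk J (z • K) / ((L : ℂ) ^ 6)) (Metric.ball (0:ℂ) R)
    exact (((hdiff K).2.differentiableOn).div ((hdiff K).1.differentiableOn)
      (fun z hz => (hstab _ (hadm z hz)).1)).div_const _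
  have hg_bound : ∀ z ∈ Metric.ball (0:ℂ) R, ‖g z‖ ≤ B := fun z hz => (hstab _ (hadm z hz)).2
  have hg0 : g 0 = cratio L J 0 := by
    simp [hg_def]
  have hg1 : g 1 = cratio L J K := by
    simp [hg_def]
  have h0 : (0:ℂ) ∈ Metric.ball (0:ℂ) R := Metric.mem_ball_self hRpos
  -- Step 3: Schwarz lemma.
  have hmaps : Set.MapsTo g (Metric.ball (0:ℂ) R) (Metric.closedBall (g 0) (2 * B)) := by
    intro z hz
    rw [Metric.mem_closedBall, dist_eq_norm]
    calc ‖g z - g 0‖ ≤ ‖g z‖ + ‖g 0‖ := norm_sub_le _ _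
      _ ≤ B + B := add_le_add (hg_bound z hz) (hg_bound 0 h0)
      _ = 2 * B := by ring
  have hS := Complex.dist_le_div_mul_dist_of_mapsTo_ball hg_diff hmaps h1
  rw [dist_zero_right, norm_one, mul_one, dist_eq_norm, hg1, hg0] at hS
  have hkey : ‖cratio L J K - cratio L J 0‖ ≤ a₀ / 2 := by
    refine hS.trans (le_of_eq ?_)
    rw [hR_def]
    field_simp
    ring
  have hre : (cratio L J 0).re - (cratio L J K).re ≤ a₀ / 2 := by
    have h := Complex.re_le_norm (cratio L J 0 - cratio L J K)
    rw [Complex.sub_re, norm_sub_rev] at h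
    exact h.trans hkey
  linarith

end Summit.HubbardSuperconductivity.HubbardSuperconductivity.Theorems.PerturbedXYOrder

end
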